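import Literature.NumberTheory.LFunctions.WeilCriterionConverseDirichlet
import Literature.NumberTheory.LFunctions.Weil1952CriterionDirichletProofs
import HarnessLib

/-!
# Weil's criterion for a primitive Dirichlet `L`-function, AS PRINTED: the named fact discharged

DISCHARGE of `Literature.NumberTheory.LFunctions.Weil1952_criterion_dirichlet`
(`WeilExplicitDirichlet.lean`), the «lemme» of A. Weil, *Sur les "formules explicites" de la
théorie des nombres premiers*, Comm. Sém. Math. Univ. Lund (1952), p. 262, for the `L(s)` of his (2)
with `k = ℚ` and `χ` primitive modulo `q ≠ 1`: `L(s, χ)` satisfies the Riemann hypothesis iff the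
zero side of (11) is `≥ 0` for every `F = F₀ * \overline{F₀(−x)}`, `F₀` in Weil's class (A), (B).
The two halves are the tree's

* `Weil1952_criterion_dirichlet_mp` (`Weil1952CriterionDirichletProofs.lean`, the «il faut» half:
  under GRH the zero side of an autocorrelation is `Σ m_χ(ρ) |Φ₀(ρ)|² ≥ 0`, absolutely convergent);
* `Weil1952_criterion_dirichlet_mpr` / `Weil1952_criterion_dirichlet_of_mp`
  (`WeilCriterionConverseDirichlet.lean`, the «il suffit» half: Weil's Gaussian test functions,
  Bombieri's rendering, transposed to `L(s, χ)`),

assembled here in the one line the two files were written for.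

## References

* A. Weil, *Sur les "formules explicites" de la théorie des nombres premiers*, Comm. Sém. Math.
  Univ. Lund, tome supplémentaire dédié à Marcel Riesz (1952), 252–265, the «lemme» p. 262.
  [Weil1952FormulesExplicites]
* E. Bombieri, *Remarks on Weil's quadratic functional in the theory of prime numbers I*, Rend.
  Mat. Acc. Lincei (9) 11 (2000), 183–233, Theorem 1. [Bombieri2000Weil]
-/

namespace Literature.NumberTheory.LFunctions

/-- **DISCHARGE of `Literature.NumberTheory.LFunctions.Weil1952_criterion_dirichlet`: Weil's
criterion (the «lemme», p. 262) for a primitive Dirichlet character `χ` modulo `q ≠ 1`**: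
`L(s, χ)` satisfies the Riemann hypothesis iff for every `F₀` in Weil's class (A), (B) the zero side
of the explicit formula (11) for `F = F₀ * \overline{F₀(−x)}` converges to a value `≥ 0`.
[cite: Weil1952FormulesExplicites, the «lemme» p. 262; Bombieri2000Weil, Theorem 1] -/
theorem Weil1952_criterion_dirichlet_holds : Weil1952_criterion_dirichlet :=
  Weil1952_criterion_dirichlet_of_mp fun _ hq hprim hGRH _ hF₀ ↦
    Weil1952_criterion_dirichlet_mp hq hprim hGRH hF₀

end Literature.NumberTheory.LFunctions
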